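import Literature.Algebra.Homology.DiscreteRepContinuousCohomologyLES
import Literature.Algebra.Homology.DiscreteRepStandardResolutionRestriction
import Literature.Algebra.Homology.DiscreteRepRestrictionExact
import HarnessLib

/-!
# The connecting homomorphisms of continuous cohomology commute with restriction

Topic `Algebra/Homology`; namespace `Literature.Algebra.Homology.DiscreteRep`.  Sequel of
`DiscreteRepContinuousCohomologyLES` (the long exact sequence of `continuousCohomology` for a short
exact sequence `0 → X₁ → X₂ → X₃ → 0` of discrete modules over a compact group, by transport from
`Ext`) and `DiscreteRepStandardResolutionRestriction` (the comparison commutes with restriction);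
no named fact, no `sorry`.

For `U ≤ Γ` open of finite index, the restricted sequence `0 → Res X₁ → Res X₂ → Res X₃ → 0` of
`U`-modules has its own connecting homomorphism `δ_U`, and **`Hⁿ⁺¹(res) ∘ δ = δ_U ∘ Hⁿ(res)`**
(`map_res_connectingHom`): on the `Ext` side restriction is the exact functor `Res` which maps the
class `[S]` of the sequence to the class of the restricted sequence (`Ext.mapExactFunctor_extClass`).

## References
* D. Harari, *Galois Cohomology and Class Field Theory*, Springer (2020), Theorem 1.17 and §1.5
  (compatibility of `res` with the long exact sequence). [Harari2020]
-/

noncomputable section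

universe u

namespace Literature.Algebra.Homology

namespace DiscreteRep

open CategoryTheory CategoryTheory.Limits CategoryTheory.Abelian TopRep ContinuousCohomology

variable {k Γ : Type u} [CommRing k] [TopologicalSpace k] [Group Γ] [TopologicalSpace Γ]
  [IsTopologicalGroup Γ] [CompactSpace Γ] (U : Subgroup Γ) [CompactSpace U] (hU : IsOpen (U : Set Γ))
  [U.FiniteIndex]
  {X₁ X₂ X₃ : TopRep.{u} k Γ} [DiscreteTopology X₁.V] [DiscreteTopology X₂.V] [DiscreteTopology X₃.V]
  (h₁ : IsDiscrete ((forgetTop k Γ).obj X₁)) (h₂ : IsDiscrete ((forgetTop k Γ).obj X₂))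
  (h₃ : IsDiscrete ((forgetTop k Γ).obj X₃))
  (f : X₁ ⟶ X₂) (g : X₂ ⟶ X₃) (hfg : ∀ x, g.hom (f.hom x) = 0) (hf : Function.Injective f.hom)
  (hg : Function.Surjective g.hom) (hex : ∀ y, g.hom y = 0 → ∃ x, f.hom x = y)

/-- The restricted morphism `Res X₁ ⟶ Res X₂` (same underlying map). [cite: Harari2020, §1.5] -/
abbrev resTopMap {X Y : TopRep.{u} k Γ} (φ : X ⟶ Y) : resTop U X ⟶ resTop U Y :=
  (TopRep.resFunctor (inclT U : U →* Γ)).map φ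

omit [U.FiniteIndex] in
/-- `Res` of the short exact sequence of `C_Γ` is the short exact sequence of the restricted data in
`C_U` (definitionally). [cite: Harari2020, §1.5] -/
theorem shortComplex_map_resD :
    (shortComplex h₁ h₂ h₃ f g hfg).map (resD k U) =
      shortComplex (isDiscrete_resTop U h₁) (isDiscrete_resTop U h₂) (isDiscrete_resTop U h₃)
        (resTopMap U f) (resTopMap U g) hfg := rfl

omit [U.FiniteIndex] in
/-- `Res [S] = [Res S]` for the classes in `Ext¹`. [cite: Harari2020, §1.5] -/
theorem mapExactFunctor_extClass_shortComplex :
    (shortComplex_shortExact h₁ h₂ h₃ f g hfg hf hg hex).extClass.mapExactFunctor (resD k U) =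
      (shortComplex_shortExact (isDiscrete_resTop U h₁) (isDiscrete_resTop U h₂)
        (isDiscrete_resTop U h₃) (resTopMap U f) (resTopMap U g) hfg hf hg hex).extClass :=
  (Ext.mapExactFunctor_extClass (resD k U) _).trans rfl

include hU in
/-- **`Hⁿ⁺¹(res) ∘ δ = δ_U ∘ Hⁿ(res)`**: the connecting homomorphisms of the long exact sequences of
continuous cohomology over `Γ` and over the open subgroup `U` commute with restriction.
[cite: Harari2020, Theorem 1.17 and §1.5] -/
theorem map_res_connectingHom (n : ℕ) (c : (continuousCohomology n X₃ : TopModuleCat.{u} k)) :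
    (ContinuousCohomology.map (inclT U) (X := X₁) (Y := resTop U X₁) (𝟙 _) (n + 1)).hom
        (connectingHom h₁ h₂ h₃ f g hfg hf hg hex n c) =
      connectingHom (isDiscrete_resTop U h₁) (isDiscrete_resTop U h₂) (isDiscrete_resTop U h₃)
        (resTopMap U f) (resTopMap U g) hfg hf hg hex n
        ((ContinuousCohomology.map (inclT U) (X := X₃) (Y := resTop U X₃) (𝟙 _) n).hom c) := by
  obtain ⟨x, rfl⟩ := (extTrivAddEquivContinuousCohomology X₃ h₃ n).surjective c
  have e₁ := DFunLike.congr_fun (connectingHom_comp h₁ h₂ h₃ f g hfg hf hg hex n) x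
  have e₂ : connectingHom (isDiscrete_resTop U h₁) (isDiscrete_resTop U h₂) (isDiscrete_resTop U h₃)
      (resTopMap U f) (resTopMap U g) hfg hf hg hex n
      (extTrivAddEquivContinuousCohomology (resTop U X₃) (isDiscrete_resTop U h₃) n
        (x.mapExactFunctor (resD k U))) =
      extTrivAddEquivContinuousCohomology (resTop U X₁) (isDiscrete_resTop U h₁) (n + 1)
        ((x.mapExactFunctor (resD k U)).comp (shortComplex_shortExact (isDiscrete_resTop U h₁)
          (isDiscrete_resTop U h₂) (isDiscrete_resTop U h₃) (resTopMap U f) (resTopMap U g)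
          hfg hf hg hex).extClass rfl) :=
    DFunLike.congr_fun (connectingHom_comp (isDiscrete_resTop U h₁) (isDiscrete_resTop U h₂)
      (isDiscrete_resTop U h₃) (resTopMap U f) (resTopMap U g) hfg hf hg hex n)
      (x.mapExactFunctor (resD k U))
  simp only [AddMonoidHom.coe_comp, AddMonoidHom.coe_coe, Function.comp_apply] at e₁
  have e₃ : ((x.comp (shortComplex_shortExact h₁ h₂ h₃ f g hfg hf hg hex).extClass rfl).mapExactFunctor
      (resD k U)) =
      (x.mapExactFunctor (resD k U)).comp (shortComplex_shortExact (isDiscrete_resTop U h₁)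
        (isDiscrete_resTop U h₂) (isDiscrete_resTop U h₃) (resTopMap U f) (resTopMap U g)
        hfg hf hg hex).extClass rfl := by
    rw [Ext.mapExactFunctor_comp, mapExactFunctor_extClass_shortComplex U h₁ h₂ h₃ f g hfg hf hg hex]
    rfl
  rw [e₁, extTrivAddEquivContinuousCohomology_res U h₃ hU n x,
    extTrivAddEquivContinuousCohomology_res U h₁ hU (n + 1), e₂]
  exact congrArg (extTrivAddEquivContinuousCohomology (resTop U X₁) (isDiscrete_resTop U h₁) (n + 1)) e₃

end DiscreteRep

end Literature.Algebra.Homology
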